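import Literature.GroupTheory.ArithmeticGroups.UnitaryRealApproximation

/-!
# Real approximation for unitary groups: transfer to `GL n ℂ` and to conjugate forms

Sequel of `UnitaryRealApproximation.lean` (`RealApproximation.closure_kUnitary`: for a dense
conjugation-stable subfield `K ⊆ ℂ` and a hermitian `H ∈ Mₙ(K)` with `det H ≠ 0`, the `K`-points `U(H)(K)`
are dense in `U(H) ⊆ Mₙ(ℂ)`).  Here the statement is moved to the topology of `GL n ℂ` (Mathlib topologises
units through the embedding `u ↦ (u, u⁻¹)`; over `ℂ` inversion is continuous on invertible matrices, so the
coercion `GL n ℂ → Mₙ(ℂ)` is an embedding, `isEmbedding_coe_GL`) and along a frame `Tᴴ H T = J`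
(`section Transport`: avatars `u ↦ T u T⁻¹` between `U(J)` and `U(H)`):

* **`dense_kPoints`** : for any subgroup `S ≤ GL n ℂ` cut out by `gᴴ J g = J` and any `T ∈ GL n ℂ` with
  `Tᴴ H T = J`, the elements `u ∈ S` whose `H`-avatar `T u T⁻¹` has entries in `K` are dense in `S`;
* `dense_kPoints_self` : the case `T = 1`, `J = H`.

All statements are proved from Mathlib; tags are [folklore].

## Provenance

Staged by the pub-hodgecm formalisation cell (DAG-node prover #01 lineage) under the LEAN-IN-TREE rule; it
supersedes lines 462–583 of the cell's standalone package file `HodgeCM/PerL34/RealApproximation.lean`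
(namespace `HodgeCM.PerL34.RealApproximation` ↦ `Literature.GroupTheory.ArithmeticGroups.RealApproximation`,
same short names).  In the cell's usage `n = Fin 3`, `J = diag(1,1,-1)`, `S = U(2,1)` and `K = ι₁(L)` for a CM
field `L`.

## Not here

Anything specific to signature `(2,1)` or to the complex ball.
-/

set_option autoImplicit false

noncomputable section

open Matrix Topology Filter
open scoped ComplexConjugate
open Literature.LinearAlgebra.Matrix

namespace Literature.GroupTheory.ArithmeticGroups

namespace RealApproximation

variable {n : Type*} [Fintype n] [DecidableEq n]

/-! ## Transfer to `GL n ℂ` and to conjugate forms -/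

/-- Matrix inversion is continuous on the invertible matrices over `ℂ`. [folklore] -/
theorem continuousOn_inv : ContinuousOn (Inv.inv : Matrix n n ℂ → Matrix n n ℂ) {A | IsUnit A} := by
  intro A hA
  have hd : A.det ≠ 0 := ((isUnit_iff_isUnit_det A).mp hA).ne_zero
  refine (continuousAt_matrix_inv A ?_).continuousWithinAt
  rw [Ring.inverse_eq_inv']
  exact continuousAt_inv₀ hd

/-- The coercion `GL n ℂ → Mₙ(ℂ)` is a topological embedding (Mathlib topologises units through
`M × Mᵐᵒᵖ`; over `ℂ` inversion is continuous on `GLₙ`, so this is the subspace topology).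
[folklore] -/
theorem isEmbedding_coe_GL : IsEmbedding (Units.val : GL n ℂ → Matrix n n ℂ) :=
  Units.isEmbedding_val_mk' continuousOn_inv fun u => (Matrix.coe_units_inv u).symm

/-! ### Transport of structure along a frame `Tᴴ H T = J` -/

section Transport

variable {H J Tm Ti : Matrix n n ℂ}

/-- If `Tᴴ H T = J` and `T T⁻¹ = 1` then `H = T⁻ᴴ J T⁻¹`. [folklore] -/
theorem form_transport (hT : Tmᴴ * H * Tm = J) (hTTi : Tm * Ti = 1) : H = Tiᴴ * J * Ti := by
  rw [← hT]
  simp only [Matrix.mul_assoc]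
  rw [hTTi, Matrix.mul_one, ← Matrix.mul_assoc, ← conjTranspose_mul, hTTi, conjTranspose_one, Matrix.one_mul]

/-- Conjugation `u ↦ T u T⁻¹` carries `U(J)` into `U(H)` ("the `H`-avatar of `u`"). [folklore] -/
theorem avatar_unitary (hT : Tmᴴ * H * Tm = J) (hTTi : Tm * Ti = 1) (hTiT : Ti * Tm = 1) {u : Matrix n n ℂ}
    (huJ : uᴴ * J * u = J) : (Tm * u * Ti)ᴴ * H * (Tm * u * Ti) = H := by
  rw [form_transport hT hTTi]
  simp only [conjTranspose_mul, Matrix.mul_assoc]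
  rw [← Matrix.mul_assoc Ti Tm, hTiT, Matrix.one_mul, ← Matrix.mul_assoc Tmᴴ Tiᴴ, ← conjTranspose_mul,
    hTiT, conjTranspose_one, Matrix.one_mul, ← Matrix.mul_assoc _ J, ← Matrix.mul_assoc (_ * J), huJ]

/-- Conjugation `Y ↦ T⁻¹ Y T` carries `U(H)` into `U(J)`. [folklore] -/
theorem coavatar_unitary (hT : Tmᴴ * H * Tm = J) (hTTi : Tm * Ti = 1) {Y : Matrix n n ℂ}
    (hY : Yᴴ * H * Y = H) : (Ti * Y * Tm)ᴴ * J * (Ti * Y * Tm) = J := by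
  have hHJ := form_transport hT hTTi
  simp only [conjTranspose_mul, Matrix.mul_assoc]
  rw [← Matrix.mul_assoc Tiᴴ J, ← Matrix.mul_assoc (Tiᴴ * J) Ti, ← hHJ, ← Matrix.mul_assoc Yᴴ,
    ← Matrix.mul_assoc (Yᴴ * H), hY, ← Matrix.mul_assoc, hT]

/-- `T (T⁻¹ Y T) T⁻¹ = Y`. [folklore] -/
theorem avatar_coavatar (hTTi : Tm * Ti = 1) (Y : Matrix n n ℂ) : Tm * (Ti * Y * Tm) * Ti = Y := by
  simp only [Matrix.mul_assoc]
  rw [hTTi, Matrix.mul_one, ← Matrix.mul_assoc, hTTi, Matrix.one_mul]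

/-- `T⁻¹ (T u T⁻¹) T = u`. [folklore] -/
theorem coavatar_avatar (hTiT : Ti * Tm = 1) (u : Matrix n n ℂ) : Ti * (Tm * u * Ti) * Tm = u := by
  simp only [Matrix.mul_assoc]
  rw [hTiT, Matrix.mul_one, ← Matrix.mul_assoc, hTiT, Matrix.one_mul]

/-- A frame forces `det H ≠ 0` as soon as `det J ≠ 0`. [folklore] -/
theorem det_ne_zero_of_frame (hT : Tmᴴ * H * Tm = J) (hJ : J.det ≠ 0) : H.det ≠ 0 := by
  intro h0
  apply hJ
  rw [← hT, det_mul, det_mul, h0, mul_zero, zero_mul]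

/-- ... and `det J ≠ 0` as soon as `det H ≠ 0` and `T` is invertible. [folklore] -/
theorem det_ne_zero_of_frame' (hT : Tmᴴ * H * Tm = J) (hTTi : Tm * Ti = 1) (hHd : H.det ≠ 0) : J.det ≠ 0 := by
  have hTd : Tm.det ≠ 0 := Matrix.det_ne_zero_of_right_inverse hTTi
  rw [← hT, det_mul, det_mul, det_conjTranspose]
  exact mul_ne_zero (mul_ne_zero (star_ne_zero.mpr hTd) hHd) hTd

/-- An element of `U(J)` has non-zero determinant if `det J ≠ 0`. [folklore] -/
theorem det_ne_zero_of_unitary (hJ : J.det ≠ 0) {u : Matrix n n ℂ} (hu : uᴴ * J * u = J) : u.det ≠ 0 := by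
  intro h0
  apply hJ
  rw [← hu, det_mul, det_mul, h0, mul_zero]

end Transport

variable (K : Subfield ℂ)

/-- **Main theorem (group form).**  Let `S ≤ GL n ℂ` be the subgroup cut out by `gᴴ J g = J`, and let
`T ∈ GL n ℂ` carry the hermitian `K`-matrix `H` (`det H ≠ 0`) to `J`: `Tᴴ H T = J`.  Then the elements `u ∈ S`
whose `H`-avatar `T u T⁻¹` is `K`-rational — i.e. the image of `U(H)(K)` under `G ↦ T⁻¹ G T` — are dense in `S`
(for the topology of `GL n ℂ`).  For `K = ι₁(L)`, `H = Hm^{ι₁}`, `J = diag(1,1,-1)` this is PerL's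
"`Δ = image of G_U(L₀)` is dense in `U(2,1)`" (ll. 672–677); see `RealApproximationBall.lean`.
[folklore] -/
theorem dense_kPoints (hK : ∀ z ∈ K, conj z ∈ K) (hKd : Dense (K : Set ℂ)) {H : Matrix n n ℂ}
    (hHK : IsKMat K H) (hH : Hᴴ = H) (hHd : H.det ≠ 0) (T : GL n ℂ) (J : Matrix n n ℂ)
    (hT : (T : Matrix n n ℂ)ᴴ * H * (T : Matrix n n ℂ) = J) (S : Subgroup (GL n ℂ))
    (hS : ∀ g : GL n ℂ, g ∈ S ↔ (g : Matrix n n ℂ)ᴴ * J * (g : Matrix n n ℂ) = J) :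
    Dense {u : S | IsKMat K ((T : Matrix n n ℂ) * ((u : GL n ℂ) : Matrix n n ℂ) * ((T⁻¹ : GL n ℂ) : Matrix n n ℂ))} := by
  have hind : IsInducing (fun u : S => (((u : GL n ℂ)) : Matrix n n ℂ)) :=
    isEmbedding_coe_GL.isInducing.comp IsEmbedding.subtypeVal.isInducing
  rw [hind.dense_iff]
  rintro ⟨u, hu⟩
  have huJ : ((u : GL n ℂ) : Matrix n n ℂ)ᴴ * J * ((u : GL n ℂ) : Matrix n n ℂ) = J := (hS u).mp hu
  set Tm : Matrix n n ℂ := (T : Matrix n n ℂ) with hTm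
  set Ti : Matrix n n ℂ := ((T⁻¹ : GL n ℂ) : Matrix n n ℂ) with hTi
  have hTTi : Tm * Ti = 1 := by rw [hTm, hTi, ← Units.val_mul, mul_inv_cancel, Units.val_one]
  have hTiT : Ti * Tm = 1 := by rw [hTm, hTi, ← Units.val_mul, inv_mul_cancel, Units.val_one]
  -- the H-avatar `G = T u T⁻¹` of `u` is in `U(H)`, hence in the closure of `U(H)(K)`
  have hcl := closure_kUnitary hK hKd hHK hH hHd (avatar_unitary hT hTTi hTiT huJ)
  -- pull back along the continuous map `Y ↦ T⁻¹ Y T`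
  let ψ : Matrix n n ℂ → Matrix n n ℂ := fun Y => Ti * Y * Tm
  have hψc : Continuous ψ := (continuous_const.matrix_mul continuous_id).matrix_mul continuous_const
  have himg := hψc.continuousWithinAt.mem_closure_image hcl
  rw [show ψ (Tm * (u : Matrix n n ℂ) * Ti) = (u : Matrix n n ℂ) from coavatar_avatar hTiT _] at himg
  refine closure_mono ?_ himg
  rintro _ ⟨Y, ⟨hYK, hY⟩, rfl⟩
  -- `ψ Y` preserves `J`, has non-zero determinant, and its `H`-avatar is `Y`
  have hψY : (ψ Y)ᴴ * J * ψ Y = J := coavatar_unitary hT hTTi hY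
  have hdet : (ψ Y).det ≠ 0 := det_ne_zero_of_unitary (det_ne_zero_of_frame' hT hTTi hHd) hψY
  let g : GL n ℂ := Matrix.GeneralLinearGroup.mkOfDetNeZero (ψ Y) hdet
  have hg : (g : Matrix n n ℂ) = ψ Y := rfl
  have hgS : g ∈ S := (hS g).mpr (by rw [hg]; exact hψY)
  refine ⟨⟨g, hgS⟩, ?_, hg⟩
  show IsKMat K (Tm * (ψ Y) * Ti)
  rw [show Tm * ψ Y * Ti = Y from avatar_coavatar hTTi Y]
  exact hYK

/-- Special case `T = 1`, `J = H`: the `K`-points of `S = U(H) ≤ GL n ℂ` are dense in `S`.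
[folklore] -/
theorem dense_kPoints_self (hK : ∀ z ∈ K, conj z ∈ K) (hKd : Dense (K : Set ℂ)) {H : Matrix n n ℂ}
    (hHK : IsKMat K H) (hH : Hᴴ = H) (hHd : H.det ≠ 0) (S : Subgroup (GL n ℂ))
    (hS : ∀ g : GL n ℂ, g ∈ S ↔ (g : Matrix n n ℂ)ᴴ * H * (g : Matrix n n ℂ) = H) :
    Dense {u : S | IsKMat K (((u : GL n ℂ)) : Matrix n n ℂ)} := by
  have h := dense_kPoints K hK hKd hHK hH hHd 1 H (by simp) S hS
  simpa using h

end RealApproximation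

end Literature.GroupTheory.ArithmeticGroups
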